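import Literature.MathematicalPhysics.QuantumFieldTheory.Balaban1983to89.Node00.TkFirstStepRegionVanishing
import Literature.MathematicalPhysics.QuantumFieldTheory.Balaban1983to89.B14SeparationOfRecord
import Literature.MathematicalPhysics.QuantumFieldTheory.Balaban1983to89.B15Claim189LambdaPin

/-!
# DAG node N11 — THE SUPPORT OF def-T's STEP WEIGHTS OF RECORD IN (3.2) ∕ (3.3) ∕ (3.5) CURRENCY: wherever `w_k(s′)(U, V′) ≠ 0`, the label `t` producing `s′` has
# (3.2)-small one-cube BACKGROUNDS of `V′` off `P_{k+1}` and (3.3)-small approximate fluctuations of `U` off `Q_{k+1}`, and EVERY χ-cube of `Ω_{k+1}(s′)` is such a cube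
# — the def-T half of the (B4) ∕ (O3′) road's support clause `hwS`

HEADER — WORK-UNIT METADATA.  Cell `pub-ymgap`, YM-PLAN Track A (HUMAN RULING D-0062 ∕ D-0149), width seat `pub-ymgap-dag-n11-w2` (g4; WIDTH SEAT 2∕4 on N11 [B14]),
route `BalabanUVNodes`; this seat's jail key is K1⁷ `stmt-QuantumFields-20542` (`--kind proof --supports 20542 --as helper`, count-neutral); the K1 face of record since
KEY MAP v2 is K1⁹ `StabilityBRunRowsAtRecordR13SepCoPHV` = stmt-QuantumFields-27364 (MIS-KEY ∕ VALID rule R463 (4)(a): lineage BY NAME).  [III] = [Balaban1988Convergent].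
Over node00-def-T's `Node00/StepWeightsOfRecord` (n02-b: `wOfRecord = stepWeightsOfResum … σOfRecord ωOfRecord`, `ωOfRecord = aWeight·bWeight·ζ`, `aWeight` ∕ `bWeight` =
r11's (3.2) ∕ (3.3) products pinned, `OmegaOfLabel` ∕ `Omega0` ∕ `qcubes` ∕ `cubes32` ∕ `hullD` ∕ `innerD` ∕ `fillD`, `cubesIn_OmegaOfLabel_subset`, `σOfRecord_Ω_succ`),
`Node00/RepTowerOfRecord` (`resumWeights`), r11's `B14Sect3Decomp` (`chiNext`, `chiNextc`, `chiPrime`, `SmallApproxFluct`), the tree's `Setup.chiSmall` ∕ `PlaqSmallOn`,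
`Node00/TkFirstStepRegionVanishing` (`subset_hullD_self`, `cubeχ_subset_cubesχ`) and dag-n11-e's `B14SeparationOfRecord` (`mem_hullD_iff`).  Bus: OFFER ∕ CLAIM-10 of g4
(first refusal to dag-n09-w5 — «(S) = n09-w5's pen» —, the dag-n11-w6 lineage (LOCATED (o4)) and the def-T ∕ def-R lineage).

WHY THIS FILE.  The (B4) ∕ (O3′) road displays ONE support clause: dag-n11-d's `hwS` («`w(s′)(e_β q, avg) ≠ 0 ⇒` every off-`sV′` central bond variable sits in its window»),
dag-n11-w6's p629018 ∕ dag-n08-w2's FILE 10 in loop ∕ plaquette currency («`w_k(s′)(U, V′) ≠ 0 ⇒` the (0.4) loops ∕ the plaquettes of `U` at the blocks of the bonds of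
`Ω_{k+1}(s′)` are small»).  In print this is what the resummed small-field restrictions (3.2)–(3.5) GIVE.  In the tree the step weights of record are exactly that resummation
(def-T FILE 3): `w_k(s′)(U,V′) = Σ_{t : σ(init s′) t = s′} a(P)(V′)·b(P,Q)(U,V′)·ζ(R,S)(U,V′)` with `a(P) = [P ⊆ cubes32]·χ_{k+1}(cubes32 ∖ P)·χᶜ_{k+1}(P)` (the (3.2) characteristic
functions of the one-cube BACKGROUNDS `U_{k+1,□′}(V′)`: `sup_{p ⊂ □′~} |U_{k+1,□′}(V′)(∂p) − 1| < ε_{k+1}η²`), `b(P,Q) = [Q ⊆ qcubes P]·χ′_k(qcubes P ∖ Q)·χ′ᶜ_k(Q)` (the (3.3)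
events `|U(b)(V^{(k)}_{□′}(b))⁻¹ − 1| < 2δ_k` on `(□′~²)^{(k)*}`), and `Ω_{k+1}(s′) = OmegaOfLabel (init s′) t` ((3.5), guarded and filled).  THIS FILE unpacks it: a non-zero
step weight exhibits a label `t` (§1) whose (3.2) factor forces small plaquettes of the coarse one-cube backgrounds on every cube of `cubes32 ∖ P` (§2), whose (3.3) factor forces the
small-approximate-fluctuation event on every cube of `qcubes P ∖ Q` (§3); and by (3.5)'s construction every χ-cube inside `Ω_{k+1}(t)` is in BOTH families (§4: off `P` by def-T's
`cubesIn_OmegaOfLabel_subset`; off `Q` and inside `(B^{k+1}(P))^{∼−1}` because `Ω_{k+1} ⊆ Omega0 = (hull₂(hull₀(Q̃) ∪ hull₀(B^{k+1}(P)ᶜ)))ᶜ`).  §5 assembles: wherever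
`w_k(s′)(U,V′) ≠ 0`, AROUND EVERY χ-CUBE OF `Ω_{k+1}(s′)` the coarse one-cube background has (3.2)-small plaquettes AND the fine field is (3.3)-close to its level-`k` average.
What then REMAINS of `hwS` in loop ∕ plaquette currency is ONE lattice-gauge step — «(3.2) on `U_{k+1,□′}(V′)` + (3.3) closeness ⇒ small level-`k` loops of `U` at the blocks»
(block-averaging Stokes bounds, pub-balaban `BlockAveragingPlaquetteBoundLocal` territory) — NOT claimed here.

WHAT THIS FILE PROVES (0 `sorry`, 0 `def`, standard axioms).
§1 ★ `exists_label_of_wOfRecord_ne_zero` (`w ≠ 0 ⇒ ∃ t, σ(init s′) t = s′ ∧ a ≠ 0 ∧ b ≠ 0 ∧ ζ ≠ 0`).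
§2 ★ `plaqSmallOn_ukLoc_of_aWeight_ne_zero` (`a(P)(V′) ≠ 0 ⇒ P ⊆ cubes32 ∧ ∀ c ∈ cubes32 ∖ P`, (3.2)'s `PlaqSmallOn (plaqT c) (ε_{k+1}η²) (U_{k+1,c}(V′))`).
§3 ★ `smallApproxFluct_of_bWeight_ne_zero` (`b(P,Q)(U,V′) ≠ 0 ⇒ Q ⊆ qcubes P ∧ ∀ c ∈ qcubes P ∖ Q`, (3.3)'s `SmallApproxFluct … U V′ c`).
§4 `hullD_mono_set` · ★ `cubesIn_OmegaOfLabel_subset_qcubes` (every χ-cube inside `Ω_{k+1}(t)` lies in `qcubes P ∖ Q`; `0 < sideD`).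
§5 ★★ `support_of_wOfRecord_ne_zero` (the assembled support statement in (3.2) ∕ (3.3) currency at every χ-cube of `Ω_{k+1}(s′)`).

HONEST FRAMING.  Helper lane, count-neutral; DEFINITION UNPACKING of def-T's ∕ r11's own objects and finite-sum ∕ finite-product bookkeeping BY NAME; the (3.2) ∕ (3.3) events are
print's characteristic functions READ OFF the tree's step weights — nothing of Bałaban's analysis (no regularity of minimisers, no Stokes bound, no chart) is asserted; the loop ∕
plaquette form of the support clause is NOT derived here; (B4) ∕ (S-α) ∕ (O3′) NOT closed; N11 NOT discharged; K1⁹ NOT closed, no registered stub touched; counts unmoved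
(typed 28∕28 · discharged 5∕27 · A 5∕28).  One finite `𝕋⁴_{L^K}` programme at fixed `ε = L^{−K}`; R4 closes only the conditional finite-𝕋⁴ rung `BalabanLadder.UV` — NOT ℝ⁴,
NOT OS, NOT a mass gap, NOT Clay.  No `sorry`, `axiom`, `def`, `instance`, `notation`.  Sources (SHAPE ∕ bookkeeping only): [III] (3.2)–(3.5) p.265, (3.16) p.268, (3.20)–(3.21)
p.269, p.267, (2.1) p.254, (2.16)–(2.17) p.257; [Balaban1987RG1] (0.4) p.253.
-/

noncomputable section

open MeasureTheory
open scoped BigOperators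

namespace Summit.QuantumFields.YangMills.Theorems.BalabanUVNodesN11StepWeightSupportOfRecord

open Literature.MathematicalPhysics.QuantumFieldTheory.Balaban1983to89
open Literature.MathematicalPhysics.QuantumFieldTheory.Balaban1983to89.Node00
open T4Continuum B14.Eq218Concrete B14.Sect3Decomp
open Literature.MathematicalPhysics.QuantumFieldTheory.Balaban1983to89.B14SeparationOfRecord (mem_hullD_iff)

variable {F : T4Family} {N : ℕ} [NeZero N]

/-! ## §1  A non-zero step weight exhibits a label -/

section Label

variable (ν : Stage7Numerics) (M : ℕ) (A₁ : ℝ) (ζ : ZetaOfRecord F N ν M) (p : B12.RunParams) (g : ℕ → ℝ) (k : ℕ)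

/-- ★ **A NON-ZERO STEP WEIGHT OF RECORD EXHIBITS A LABEL**: if `w_k(s′)(U, V′) ≠ 0` then some label `t = (P, Q, (R, S))` with `σ(init s′) t = s′` has ALL three factors
of its label weight non-zero — the (3.2) factor `a(P)(V′)`, the (3.3) factor `b(P,Q)(U,V′)` and the residual fluctuation factor `ζ(R,S)(U,V′)` (a finite sum is non-zero only
if a summand is; `ωOfRecord = a·b·ζ`). [cite: Balaban1988Convergent, (3.2)–(3.5) p.265, (3.16) p.268, (3.20)–(3.21) p.269, p.267 (bookkeeping)] -/
theorem exists_label_of_wOfRecord_ne_zero (s' : SeqOfRecord F ν M g p.K (k + 1)) (U : GaugeField (F.P p.K) k (SU N))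
    (V' : GaugeField (F.P p.K) (k + 1) (SU N)) (hw : wOfRecord F N ν M A₁ ζ p g k s' U V' ≠ 0) :
    ∃ t : LbOfRecord F ν p g k, σOfRecord F ν M p g k s'.init t = s' ∧ aWeight F N ν M p g k s'.init t.1 V' ≠ 0 ∧
      bWeight F N ν M p g k A₁ s'.init t.1 t.2.1 U V' ≠ 0 ∧ ζ p g k s'.init t.1 t.2.1 t.2.2 U V' ≠ 0 := by
  classical
  rw [wOfRecord_apply] at hw
  unfold resumWeights at hw
  obtain ⟨t, ht, hne⟩ := Finset.exists_ne_zero_of_sum_ne_zero hw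
  refine ⟨t, (Finset.mem_filter.1 ht).2, ?_⟩
  unfold ωOfRecord at hne
  exact ⟨(mul_ne_zero_iff.1 (mul_ne_zero_iff.1 hne).1).1, (mul_ne_zero_iff.1 (mul_ne_zero_iff.1 hne).1).2, (mul_ne_zero_iff.1 hne).2⟩

end Label

/-! ## §2  The (3.2) factor: small plaquettes of the coarse one-cube backgrounds off `P` -/

section Factor32

variable (ν : Stage7Numerics) (M : ℕ) (p : B12.RunParams) (g : ℕ → ℝ) (k : ℕ)

/-- ★ **THE (3.2) FACTOR READ OFF**: `a(P)(V′) ≠ 0` forces `P ⊆ cubes32` (the (3.2) range) and, on EVERY cube `c` of `cubes32 ∖ P`, the small-plaquette event of (3.2) for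
the coarse one-cube background: `PlaqSmallOn (plaqT c) (ε_{k+1}·η²) (U_{k+1,c}(V′))` — every factor of r11's `χ_{k+1}(cubes32 ∖ P)` is a `{0,1}`-characteristic function, a
non-zero finite product has non-zero factors. [cite: Balaban1988Convergent, (3.2) p.265, (2.16)–(2.17) p.257 (bookkeeping)] -/
theorem plaqSmallOn_ukLoc_of_aWeight_ne_zero (s : SeqOfRecord F ν M g p.K k) (Pl : Finset (Iχ F ν p g k))
    (V' : GaugeField (F.P p.K) (k + 1) (SU N)) (ha : aWeight F N ν M p g k s Pl V' ≠ 0) :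
    Pl ⊆ cubes32 F ν M p g k s ∧ ∀ c ∈ cubes32 F ν M p g k s \ Pl,
      PlaqSmallOn ((sect3DataOfRecord F N ν M p g k s).plaqT c) (epsOfRecord ν g (k + 1) * (F.P p.K).eta (k + 1) ^ 2)
        ((sect3DataOfRecord F N ν M p g k s).UkLoc c V') := by
  classical
  unfold aWeight at ha
  split_ifs at ha with hP
  · refine ⟨hP, fun c hc => ?_⟩
    have h1 : chiNext (sect3DataOfRecord F N ν M p g k s) (epsOfRecord ν g (k + 1)) (cubes32 F ν M p g k s \ Pl) V' ≠ 0 :=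
      (mul_ne_zero_iff.1 ha).1
    unfold chiNext at h1
    have h2 := Finset.prod_ne_zero_iff.1 h1 c hc
    unfold chiSmall at h2
    by_contra hns
    exact h2 (if_neg hns)
  · exact absurd rfl ha

end Factor32

/-! ## §3  The (3.3) factor: small approximate fluctuations off `Q` -/

section Factor33

variable (ν : Stage7Numerics) (M : ℕ) (A₁ : ℝ) (p : B12.RunParams) (g : ℕ → ℝ) (k : ℕ)

/-- ★ **THE (3.3) FACTOR READ OFF**: `b(P,Q)(U,V′) ≠ 0` forces `Q ⊆ qcubes P` (the (3.3) range `(B^{k+1}(P))^{∼−1}`) and, on EVERY cube `c` of `qcubes P ∖ Q`, the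
small-approximate-fluctuation event of (3.3): `SmallApproxFluct … (2δ_k) U V′ c`, i.e. `dist1 (U(b)·(V^{(k)}_c(V′)(b))⁻¹) < 2δ_k` for every level-`k` bond `b` of `(c~²)^{(k)*}`
(r11's `χ′_k(qcubes P ∖ Q)` is a product of `{0,1}`-indicators). [cite: Balaban1988Convergent, (3.3)–(3.4) p.265 (bookkeeping)] -/
theorem smallApproxFluct_of_bWeight_ne_zero (s : SeqOfRecord F ν M g p.K k) (Pl Ql : Finset (Iχ F ν p g k))
    (U : GaugeField (F.P p.K) k (SU N)) (V' : GaugeField (F.P p.K) (k + 1) (SU N)) (hb : bWeight F N ν M p g k A₁ s Pl Ql U V' ≠ 0) :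
    Ql ⊆ qcubes F ν M p g k s Pl ∧ ∀ c ∈ qcubes F ν M p g k s Pl \ Ql,
      SmallApproxFluct (sect3DataOfRecord F N ν M p g k s) (avOfRecord F N p.K) (2 * deltaOfRecord ν g k A₁) U V' c := by
  classical
  unfold bWeight at hb
  split_ifs at hb with hQ
  · refine ⟨hQ, fun c hc => ?_⟩
    have h1 : chiPrime (sect3DataOfRecord F N ν M p g k s) (avOfRecord F N p.K) (2 * deltaOfRecord ν g k A₁)
        (qcubes F ν M p g k s Pl \ Ql) U V' ≠ 0 := (mul_ne_zero_iff.1 hb).1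
    unfold chiPrime at h1
    have h2 := Finset.prod_ne_zero_iff.1 h1 c hc
    by_contra hns
    exact h2 (if_neg hns)
  · exact absurd rfl hb

end Factor33

/-! ## §4  (3.5)'s geometry: every χ-cube inside `Ω_{k+1}(t)` lies in the (3.3) range and avoids `Q` -/

section Geometry

variable {P : Params} {sd : ℕ}

/-- `hullD` is monotone in the set. [cite: Balaban1988Convergent, p.264–265 (bookkeeping)] -/
theorem hullD_mono_set (n : ℕ) {X Y : Set (Site P 0)} (h : X ⊆ Y) : hullD P sd n X ⊆ hullD P sd n Y := by
  intro x hx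
  obtain ⟨a, ha, ⟨z, hz, hzX⟩, hxa⟩ := mem_hullD_iff.1 hx
  exact mem_hullD_iff.2 ⟨a, ha, ⟨z, hz, h hzX⟩, hxa⟩

variable (F : T4Family) (ν : Stage7Numerics) (M : ℕ) (p : B12.RunParams) (g : ℕ → ℝ) (k : ℕ)

/-- ★ **EVERY χ-CUBE INSIDE `Ω_{k+1}(t)` LIES IN `qcubes P ∖ Q`** (the (3.3) range minus `Q`), for the 𝐃-cubes of positive side: `Ω_{k+1}(t) ⊆ Omega0(P,Q) =
(hull₂(hull₀(Q̃) ∪ hull₀((B^{k+1}(P))ᶜ)))ᶜ` ((3.5), `fillD_subset`), so a point of such a cube is neither within one layer of `(B^{k+1}(P))ᶜ` (hence in `(B^{k+1}(P))^{∼−1}`, i.e.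
the cube is in `qcubes P`) nor in a cube of `Q` (cubes are non-empty).  Companion of def-T's `cubesIn_OmegaOfLabel_subset` (the (3.2) side: `⊆ cubes32 ∖ P`).
[cite: Balaban1988Convergent, (3.5) p.265, (3.3) p.265, (2.1) p.254 (bookkeeping)] -/
theorem cubesIn_OmegaOfLabel_subset_qcubes (hD : 0 < sideD F ν M p g k) (s : SeqOfRecord F ν M g p.K k) (t : LbOfRecord F ν p g k) :
    cubesIn (cubeχ F ν p g k) (OmegaOfLabel F ν M p g k s t) ⊆ qcubes F ν M p g k s t.1 \ t.2.1 := by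
  classical
  intro c hc
  rw [mem_cubesIn] at hc
  -- `Ω_{k+1}(t) ⊆ Omega0`
  have hΩ0 : OmegaOfLabel F ν M p g k s t ⊆ Omega0 F ν M p g k s t.1 t.2.1 :=
    (fillD_subset _ _ _).trans Set.inter_subset_left
  -- the two generators of `Omega0ᶜ`
  have hgenQ : hullD (F.P p.K) (sideD F ν M p g k) 0 (cubesχ F ν p g k t.2.1) ⊆ (Omega0 F ν M p g k s t.1 t.2.1)ᶜ := by
    intro x hx
    simp only [Omega0, compl_compl]
    exact subset_hullD_self (F.P p.K) (sideD F ν M p g k) hD 2 _ (Set.mem_union_left _ hx)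
  have hgenB : hullD (F.P p.K) (sideD F ν M p g k) 1 (Bdom F ν M p g k s t.1)ᶜ ⊆ (Omega0 F ν M p g k s t.1 t.2.1)ᶜ := by
    intro x hx
    simp only [Omega0, compl_compl]
    have h1 : x ∈ hullD (F.P p.K) (sideD F ν M p g k) 2 (Bdom F ν M p g k s t.1)ᶜ :=
      B15Claim189LambdaPin.hullD_mono_layers (by norm_num : (1 : ℕ) ≤ 2) _ hx
    exact hullD_mono_set 2 ((subset_hullD_self (F.P p.K) (sideD F ν M p g k) hD 0 _).trans Set.subset_union_right) h1
  rw [Finset.mem_sdiff]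
  constructor
  · -- `c ∈ qcubes P`: its point set lies in `innerD 1 (B^{k+1}(P))`
    rw [qcubes, mem_cubesIn]
    intro x hx
    simp only [innerD, Set.mem_compl_iff]
    intro hx1
    exact (hgenB hx1) (hΩ0 (hc hx))
  · -- `c ∉ Q`: a cube of `Q` meets `hull₀(Q̃) ⊆ Omega0ᶜ`
    intro hQ
    obtain ⟨x, hx⟩ := cubeEnl_zero_nonempty (F.P p.K) (sideχ F ν p g k) c.2
    have hxQ : x ∈ cubesχ F ν p g k t.2.1 := cubeχ_subset_cubesχ F ν p g k hQ hx
    exact (hgenQ (subset_hullD_self (F.P p.K) (sideD F ν M p g k) hD 0 _ hxQ)) (hΩ0 (hc hx))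

end Geometry

/-! ## §5  Assembled: the support of the step weights of record in (3.2) ∕ (3.3) currency -/

section Support

variable (ν : Stage7Numerics) (M : ℕ) (A₁ : ℝ) (ζ : ZetaOfRecord F N ν M) (p : B12.RunParams) (g : ℕ → ℝ) (k : ℕ)

/-- ★★ **THE SUPPORT OF def-T's STEP WEIGHTS OF RECORD**: if `w_k(s′)(U, V′) ≠ 0` (𝐃-cubes of positive side), then `s′ = σ(init s′) t` for a label `t = (P, Q, (R, S))`, and AROUND
EVERY χ-CUBE `c ⊆ Ω_{k+1}(s′)`: the coarse one-cube background `U_{k+1,c}(V′)` has (3.2)-small plaquettes on `plaqT c` (`c ∈ cubes32 ∖ P`), AND the fine field is (3.3)-close to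
its level-`k` average on `(c~²)^{(k)*}` (`c ∈ qcubes P ∖ Q`).  §1 + §2 + §3 + def-T's `cubesIn_OmegaOfLabel_subset` + §4 + `σOfRecord_Ω_succ`.  The loop ∕ plaquette form of the
support clause («the level-`k` loops of `U` at the blocks of the bonds of `Ω_{k+1}(s′)` are small») is ONE lattice-gauge step away and is NOT derived here.
[cite: Balaban1988Convergent, (3.2)–(3.5) p.265, p.267 (bookkeeping); Balaban1987RG1, (0.4) p.253] -/
theorem support_of_wOfRecord_ne_zero (hD : 0 < sideD F ν M p g k) (s' : SeqOfRecord F ν M g p.K (k + 1))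
    (U : GaugeField (F.P p.K) k (SU N)) (V' : GaugeField (F.P p.K) (k + 1) (SU N)) (hw : wOfRecord F N ν M A₁ ζ p g k s' U V' ≠ 0) :
    ∃ t : LbOfRecord F ν p g k, σOfRecord F ν M p g k s'.init t = s' ∧
      ∀ c ∈ cubesIn (cubeχ F ν p g k) (s'.Ω (k + 1)),
        PlaqSmallOn ((sect3DataOfRecord F N ν M p g k s'.init).plaqT c) (epsOfRecord ν g (k + 1) * (F.P p.K).eta (k + 1) ^ 2)
            ((sect3DataOfRecord F N ν M p g k s'.init).UkLoc c V') ∧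
          SmallApproxFluct (sect3DataOfRecord F N ν M p g k s'.init) (avOfRecord F N p.K) (2 * deltaOfRecord ν g k A₁) U V' c := by
  obtain ⟨t, ht, ha, hb, -⟩ := exists_label_of_wOfRecord_ne_zero ν M A₁ ζ p g k s' U V' hw
  refine ⟨t, ht, fun c hc => ?_⟩
  have hΩ : s'.Ω (k + 1) = OmegaOfLabel F ν M p g k s'.init t := by
    rw [← ht, σOfRecord_Ω_succ, init_σOfRecord]
  rw [hΩ] at hc
  have h32 := cubesIn_OmegaOfLabel_subset F ν M p g k s'.init t hc
  have h33 := cubesIn_OmegaOfLabel_subset_qcubes F ν M p g k hD s'.init t hc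
  exact ⟨(plaqSmallOn_ukLoc_of_aWeight_ne_zero ν M p g k s'.init t.1 V' ha).2 c h32,
    (smallApproxFluct_of_bWeight_ne_zero ν M A₁ p g k s'.init t.1 t.2.1 U V' hb).2 c h33⟩

end Support

end Summit.QuantumFields.YangMills.Theorems.BalabanUVNodesN11StepWeightSupportOfRecord

end
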